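import Mathlib
import Literature.AlgebraicGeometry.Resolution.MuPTorsorLocalUniformizationRelative
import Summits.ResolutionOfSingularities.ResolutionOfSingularities.Theorems.SoloInformedToroidalExit
import Summits.ResolutionOfSingularities.ResolutionOfSingularities.Theorems.SoloInformedBothExits
import HarnessLib

/-!
# Scaled toroidal exits of the `μ_p`-torsor step (soloist, informed, s6)

Sorry-free. Lemma T₁ (`exists_model_of_toroidalPresentation₁`) solves the model-form core step
`RelMuPTorsorCoreStepsAt p k O` at an instance `A₀` whenever the generator admits a presentation
`a^p = q^p + w·x^b` over `A₀` (`p ∤ b`, `w` a unit, `x` a regular parameter with `T/(x)` regular).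
The canonical approximants of the Cutkosky–Piltant defect tower (El Hitti–Ghezzi, arXiv:1508.06983,
§4) produce, at every deep free level, presentations of the SCALED shape
`a^p = q^p + m^p·(w·x^b)` with `m ≠ 0` in `A₀` (notes: theorem-Theta.md, Thm. 2.4: either
`b ≡ 1 mod p` with `m = 1`, or `b = 1` with `m` a power of the exceptional parameter). Here we
record that the scaled shape is solved too, by passing to the generator `a₁ = (a − q)/m` of the
same extension:

* `exists_model_of_affine_generator`: the conclusion of the core step is invariant under
  `a ↦ q + m·a₁` (`q, m ∈ A₀`, `m ≠ 0`);
* `exists_model_of_scaledToroidalPresentation₁`, `exists_model_of_scaledUniformizerPresentation`: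
  `a^p = q^p + m^p·(w·x^b)` with `x` a regular parameter such that `T/(x)` is regular, resp. `x` of
  maximal value `< 1`, solves the instance.

References: El Hitti–Ghezzi (2016) Thm. 4.2, 4.4; Matsumura, *Commutative Ring Theory*, Thm. 14.2.
-/

noncomputable section

namespace Summit.ResolutionOfSingularities.ResolutionOfSingularities.Theorems

open IsLocalRing Literature.AlgebraicGeometry.Resolution

variable {k K : Type} [Field k] [Field K] [Algebra k K]

/-- **Affine change of generator.** If the core-step conclusion (a finitely generated regular model
`A ⊇ A₀` inside `k(A₀)(a₁)` containing `a₁`) holds for `a₁`, and `a = q + m·a₁` with `q, m ∈ A₀`,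
`m ≠ 0`, then it holds for `a`. -/
theorem exists_model_of_affine_generator (O : ValuationSubring K) (A₀ : Subalgebra k K)
    {a a₁ q m : K} (hq : q ∈ A₀) (hm : m ∈ A₀) (hm0 : m ≠ 0) (ha : a = q + m * a₁)
    (h : ∃ (A : Subalgebra k K) (h : A.toSubring ≤ O.toSubring), A₀ ≤ A ∧ a₁ ∈ A ∧ A.FG ∧
      (A : Set K) ⊆ IntermediateField.adjoin k (insert a₁ (A₀ : Set K)) ∧
      IsRegularLocalRing (Localization.AtPrime ((maximalIdeal O).comap (Subring.inclusion h)))) :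
    ∃ (A : Subalgebra k K) (h : A.toSubring ≤ O.toSubring), A₀ ≤ A ∧ a ∈ A ∧ A.FG ∧
      (A : Set K) ⊆ IntermediateField.adjoin k (insert a (A₀ : Set K)) ∧
      IsRegularLocalRing (Localization.AtPrime ((maximalIdeal O).comap (Subring.inclusion h))) := by
  obtain ⟨A, hA, hA₀A, ha₁, hfg, hsub, hreg⟩ := h
  refine ⟨A, hA, hA₀A, ?_, hfg, ?_, hreg⟩
  · rw [ha]; exact add_mem (hA₀A hq) (mul_mem (hA₀A hm) ha₁)
  · have ha₁eq : a₁ = (a - q) / m := by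
      rw [ha, add_sub_cancel_left, mul_div_cancel_left₀ _ hm0]
    have hle : IntermediateField.adjoin k (insert a₁ (A₀ : Set K)) ≤
        IntermediateField.adjoin k (insert a (A₀ : Set K)) := by
      apply IntermediateField.adjoin_le_iff.mpr
      intro y hy
      rcases Set.mem_insert_iff.mp hy with rfl | hy
      · rw [ha₁eq]
        refine div_mem (sub_mem ?_ ?_) ?_
        · exact IntermediateField.subset_adjoin _ _ (Set.mem_insert _ _)
        · exact IntermediateField.subset_adjoin _ _ (Set.mem_insert_of_mem _ hq)
        · exact IntermediateField.subset_adjoin _ _ (Set.mem_insert_of_mem _ hm)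
      · exact IntermediateField.subset_adjoin _ _ (Set.mem_insert_of_mem _ hy)
    exact hsub.trans (SetLike.coe_subset_coe.mpr hle)

/-- **Scaled Lemma T₁.** A presentation `a^p = q^p + m^p·(w·x^b)` over `A₀` with `m ≠ 0`, `p ∤ b`,
`w` a unit of `O`, and `x ∈ A₀` a non-unit such that `T/(x)` is regular (`T` the local ring of
`A₀` at the centre) solves the instance `A₀` of the core step: `a₁ = (a − q)/m` has the
T₁-presentation `a₁^p = 0^p + w·x^b`. -/
theorem exists_model_of_scaledToroidalPresentation₁ {p : ℕ} [hp : Fact p.Prime] [CharP K p]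
    (O : ValuationSubring K) (A₀ : Subalgebra k K) (h₀ : A₀.toSubring ≤ O.toSubring)
    (hA₀fg : A₀.FG) (hreg :
      IsRegularLocalRing (Localization.AtPrime ((maximalIdeal O).comap (Subring.inclusion h₀))))
    {a q m w x : K} {b : ℕ} (hq : q ∈ A₀) (hm : m ∈ A₀) (hm0 : m ≠ 0) (hw : w ∈ A₀) (hx : x ∈ A₀)
    (hpb : ¬ p ∣ b) (hvw : O.valuation w = 1) (hvx : O.valuation x < 1) (hx0 : x ≠ 0)
    (hf : a ^ p = q ^ p + m ^ p * (w * x ^ b))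
    (hxreg : IsRegularLocalRing (↥(locAtCentre A₀.toSubring O) ⧸
      Ideal.span {(⟨x, le_locAtCentre A₀.toSubring O hx⟩ : locAtCentre A₀.toSubring O)})) :
    ∃ (A : Subalgebra k K) (h : A.toSubring ≤ O.toSubring), A₀ ≤ A ∧ a ∈ A ∧ A.FG ∧
      (A : Set K) ⊆ IntermediateField.adjoin k (insert a (A₀ : Set K)) ∧
      IsRegularLocalRing (Localization.AtPrime ((maximalIdeal O).comap (Subring.inclusion h))) := by
  have hmp : m ^ p ≠ 0 := pow_ne_zero _ hm0
  have ha : a = q + m * ((a - q) / m) := by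
    rw [mul_div_cancel₀ _ hm0]; ring
  have hf₁ : ((a - q) / m) ^ p = (0 : K) ^ p + w * x ^ b := by
    rw [div_pow, sub_pow_char a q, hf, zero_pow hp.out.ne_zero, zero_add, add_sub_cancel_left,
      mul_div_cancel_left₀ _ hmp]
  exact exists_model_of_affine_generator O A₀ hq hm hm0 ha
    (exists_model_of_toroidalPresentation₁ O A₀ h₀ hA₀fg hreg A₀.zero_mem hw hx hpb hvw hvx hx0
      hf₁ hxreg)

/-- **Scaled Lemma T₁ along an element of maximal value.** As above, with "`T/(x)` regular"
replaced by: `x` has maximal value among the values `< 1` of `O` (automatic regularity,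
`exists_model_of_uniformizerPresentation`). -/
theorem exists_model_of_scaledUniformizerPresentation {p : ℕ} [hp : Fact p.Prime] [CharP K p]
    (O : ValuationSubring K) (A₀ : Subalgebra k K) (h₀ : A₀.toSubring ≤ O.toSubring)
    (hA₀fg : A₀.FG) (hreg :
      IsRegularLocalRing (Localization.AtPrime ((maximalIdeal O).comap (Subring.inclusion h₀))))
    {a q m w x : K} {b : ℕ} (hq : q ∈ A₀) (hm : m ∈ A₀) (hm0 : m ≠ 0) (hw : w ∈ A₀) (hx : x ∈ A₀)
    (hpb : ¬ p ∣ b) (hvw : O.valuation w = 1) (hvx : O.valuation x < 1) (hx0 : x ≠ 0)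
    (hmax : ∀ y : K, O.valuation y < 1 → O.valuation y ≤ O.valuation x)
    (hf : a ^ p = q ^ p + m ^ p * (w * x ^ b)) :
    ∃ (A : Subalgebra k K) (h : A.toSubring ≤ O.toSubring), A₀ ≤ A ∧ a ∈ A ∧ A.FG ∧
      (A : Set K) ⊆ IntermediateField.adjoin k (insert a (A₀ : Set K)) ∧
      IsRegularLocalRing (Localization.AtPrime ((maximalIdeal O).comap (Subring.inclusion h))) := by
  have hmp : m ^ p ≠ 0 := pow_ne_zero _ hm0
  have ha : a = q + m * ((a - q) / m) := by
    rw [mul_div_cancel₀ _ hm0]; ring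
  have hf₁ : ((a - q) / m) ^ p = (0 : K) ^ p + w * x ^ b := by
    rw [div_pow, sub_pow_char a q, hf, zero_pow hp.out.ne_zero, zero_add, add_sub_cancel_left,
      mul_div_cancel_left₀ _ hmp]
  exact exists_model_of_affine_generator O A₀ hq hm hm0 ha
    (exists_model_of_uniformizerPresentation O A₀ h₀ hA₀fg hreg A₀.zero_mem hw hx hpb hvw hvx hx0
      hmax hf₁)

/-- **The core step minus the U-exit and the SCALED toroidal exit.** `RelMuPTorsorCoreStepsAt p k O`
is equivalent to itself restricted to the instances `A₀` admitting NEITHER a residually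
inseparable presentation (Lemma U) NOR a scaled one-parameter toroidal presentation
`a^p = q^p + m^p·(w·x^b)` (`m ≠ 0`, `p ∤ b`, `w` a unit, `T/(x)` regular); the latter class
contains the plain T₁-presentations (`m = 1`) of `relMuPTorsorCoreStepsAt_iff_noExit`.
[cite: Matsumura1987, Thms. 14.2, 23.7 (ii); ElHittiGhezzi2016, Thm. 4.4] -/
theorem relMuPTorsorCoreStepsAt_iff_noScaledExit {p : ℕ} [Fact p.Prime] [CharP K p]
    (O : ValuationSubring K) :
    RelMuPTorsorCoreStepsAt p k O ↔
      (∀ (A₀ : Subalgebra k K) (h₀ : A₀.toSubring ≤ O.toSubring) (a : K), A₀.FG →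
        IsRegularLocalRing
          (Localization.AtPrime ((maximalIdeal O).comap (Subring.inclusion h₀))) →
        a ∉ IntermediateField.adjoin k (A₀ : Set K) → a ^ p ∈ A₀ →
        3 < Algebra.trdeg k ↥(IntermediateField.adjoin k (insert a (A₀ : Set K))) →
        ¬ IsAbhyankarPlace
            (O.comap (algebraMap ↥(IntermediateField.adjoin k (insert a (A₀ : Set K))) K))
            (algebraMap k ↥(IntermediateField.adjoin k (insert a (A₀ : Set K)))).fieldRange ⊤ →
        (¬ ∃ q m u : K, q ∈ A₀ ∧ m ∈ A₀ ∧ m ≠ 0 ∧ u ∈ A₀ ∧ a ^ p = q ^ p + m ^ p * u ∧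
            ∀ b ∈ locAtCentre A₀.toSubring O, O.valuation (b ^ p - u) = 1) →
        (¬ ∃ (q m w x : K) (b : ℕ) (hx : x ∈ A₀), q ∈ A₀ ∧ m ∈ A₀ ∧ m ≠ 0 ∧ w ∈ A₀ ∧ ¬ p ∣ b ∧
            O.valuation w = 1 ∧ O.valuation x < 1 ∧ x ≠ 0 ∧
            a ^ p = q ^ p + m ^ p * (w * x ^ b) ∧
            IsRegularLocalRing (↥(locAtCentre A₀.toSubring O) ⧸ Ideal.span
              {(⟨x, le_locAtCentre A₀.toSubring O hx⟩ : locAtCentre A₀.toSubring O)})) →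
        ∃ (A : Subalgebra k K) (h : A.toSubring ≤ O.toSubring), A₀ ≤ A ∧ a ∈ A ∧ A.FG ∧
          (A : Set K) ⊆ IntermediateField.adjoin k (insert a (A₀ : Set K)) ∧
          IsRegularLocalRing
            (Localization.AtPrime ((maximalIdeal O).comap (Subring.inclusion h)))) := by
  rw [relMuPTorsorCoreStepsAt_iff_noUExit O]
  constructor
  · intro H A₀ h₀ a hfg hreg hna hap htr hnA hnU _
    exact H A₀ h₀ a hfg hreg hna hap htr hnA hnU
  · intro H A₀ h₀ a hfg hreg hna hap htr hnA hnU
    by_cases hex : ∃ (q m w x : K) (b : ℕ) (hx : x ∈ A₀), q ∈ A₀ ∧ m ∈ A₀ ∧ m ≠ 0 ∧ w ∈ A₀ ∧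
        ¬ p ∣ b ∧ O.valuation w = 1 ∧ O.valuation x < 1 ∧ x ≠ 0 ∧
        a ^ p = q ^ p + m ^ p * (w * x ^ b) ∧
        IsRegularLocalRing (↥(locAtCentre A₀.toSubring O) ⧸ Ideal.span
          {(⟨x, le_locAtCentre A₀.toSubring O hx⟩ : locAtCentre A₀.toSubring O)})
    · obtain ⟨q, m, w, x, b, hx, hq, hm, hm0, hw, hpb, hvw, hvx, hx0, hf, hxreg⟩ := hex
      exact exists_model_of_scaledToroidalPresentation₁ O A₀ h₀ hfg hreg hq hm hm0 hw hx hpb hvw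
        hvx hx0 hf hxreg
    · exact H A₀ h₀ a hfg hreg hna hap htr hnA hnU hex

/-- **The summit with the U-exit and the scaled toroidal exit removed from its local core.**
Granted Temkin's inseparable local uniformization in height one and Cossart–Piltant in dimension
`≤ 3`, resolution of singularities in positive characteristic is EQUIVALENT to two-model patching
of proper models together with the model-form `μ_p`-torsor core steps at rank-one valuation
rings, at the instances admitting NEITHER a residually inseparable presentation NOR a scaled
one-parameter toroidal presentation `a^p = q^p + m^p·(w·x^b)`. Over the Cutkosky–Piltant defect
tower every instance at every deep free level HAS such a presentation (notes, Thm. 2.4), so the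
residual class is empty there.
[cite: Matsumura1987, Thms. 14.2, 23.7; Temkin2013, Thm. 1.3.2; CossartPiltant2019, Thm. 1.1;
ElHittiGhezzi2016, Thm. 4.2, 4.4] -/
theorem resolutionOfSingularities_iff_twoModelPatching_and_rankOneNoScaledExitCoreSteps
    (hT₁ : Temkin2013HeightLeOne.{0}) (hCP : CossartPiltant2019LU3.{0}) :
    Literature.AlgebraicGeometry.Resolution.ResolutionOfSingularities ↔
      ∀ p : ℕ, p.Prime → ProperModel.TwoModelPatching.{0} p ∧
      (∀ (k K : Type) [Field k] [CharP k p] [Field K] [Algebra k K],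
        (⊤ : IntermediateField k K).FG → ∀ O : ValuationSubring K,
          Nonempty O.valuation.RankOne → (∀ c : k, algebraMap k K c ∈ O) →
            (∀ (A₀ : Subalgebra k K) (h₀ : A₀.toSubring ≤ O.toSubring) (a : K), A₀.FG →
            IsRegularLocalRing
              (Localization.AtPrime ((maximalIdeal O).comap (Subring.inclusion h₀))) →
            a ∉ IntermediateField.adjoin k (A₀ : Set K) → a ^ p ∈ A₀ →
            3 < Algebra.trdeg k ↥(IntermediateField.adjoin k (insert a (A₀ : Set K))) →
            ¬ IsAbhyankarPlace
                (O.comap (algebraMap ↥(IntermediateField.adjoin k (insert a (A₀ : Set K))) K))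
                (algebraMap k ↥(IntermediateField.adjoin k (insert a (A₀ : Set K)))).fieldRange ⊤ →
            (¬ ∃ q m u : K, q ∈ A₀ ∧ m ∈ A₀ ∧ m ≠ 0 ∧ u ∈ A₀ ∧ a ^ p = q ^ p + m ^ p * u ∧
                ∀ b ∈ locAtCentre A₀.toSubring O, O.valuation (b ^ p - u) = 1) →
            (¬ ∃ (q m w x : K) (b : ℕ) (hx : x ∈ A₀), q ∈ A₀ ∧ m ∈ A₀ ∧ m ≠ 0 ∧ w ∈ A₀ ∧
                ¬ p ∣ b ∧ O.valuation w = 1 ∧ O.valuation x < 1 ∧ x ≠ 0 ∧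
                a ^ p = q ^ p + m ^ p * (w * x ^ b) ∧
                IsRegularLocalRing (↥(locAtCentre A₀.toSubring O) ⧸ Ideal.span
                  {(⟨x, le_locAtCentre A₀.toSubring O hx⟩ : locAtCentre A₀.toSubring O)})) →
            ∃ (A : Subalgebra k K) (h : A.toSubring ≤ O.toSubring), A₀ ≤ A ∧ a ∈ A ∧ A.FG ∧
              (A : Set K) ⊆ IntermediateField.adjoin k (insert a (A₀ : Set K)) ∧
              IsRegularLocalRing
                (Localization.AtPrime ((maximalIdeal O).comap (Subring.inclusion h))))) := by
  rw [resolutionOfSingularities_iff_twoModelPatching_and_rankOneRelCoreSteps hT₁ hCP]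
  refine forall₂_congr fun p hp => and_congr_right fun _ => forall₂_congr fun k K => ?_
  refine forall₄_congr fun _ _ _ _ => forall₃_congr fun _ O _ => forall_congr' fun _ => ?_
  haveI : Fact p.Prime := ⟨hp⟩
  haveI : CharP K p := charP_of_injective_algebraMap (algebraMap k K).injective p
  exact relMuPTorsorCoreStepsAt_iff_noScaledExit O

end Summit.ResolutionOfSingularities.ResolutionOfSingularities.Theorems
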